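import Summits.BirchSwinnertonDyer.BirchSwinnertonDyer.Theorems.ThetaPartnerAtTwoSignedControlAtTwoShaThreeBaseImaginary
import Literature.NumberTheory.GaloisRepresentations.CorestrictionTransferComparison
import Literature.NumberTheory.GaloisRepresentations.BrauerCyclicLayer
import Mathlib.Topology.Instances.ZMod
import HarnessLib

/-!
# The quadratic transfer identity `cor_{Γ_{F(√m)}} κ(√m) = κ(-m)` in `H¹(·, ℤ/2)`, explicit form (K4 `SignedControlAtTwo`,
# base case of Milne I 4.10 (c)₃, step N4 of the `hbase` road)

Route `ThetaPartnerAtTwo` (TP2), crux K4 `SignedControlAtTwo` (stmt-BirchSwinnertonDyer-20309), line `eulerchar` v12, stub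
`stub_poitouTateThreeRealRat`; width seat `bsd-wall-tp2-p3-w2` gen 7 (`--supports stmt-BirchSwinnertonDyer-20309`, helper).
For a number field `F`, `m ∈ F`, `δ ∈ F̄` with `δ² = m`, `δ ∉ F`, `γ² = δ`, `I² = -1`, put `S' = Γ_{F(δ)}` (index `2`),
`u : S' → ℤ/2` the Kummer character of `δ` at level `2` (`u h = [h γ ≠ γ]`) and `χ : Γ_F → ℤ/2` the quadratic character of
`F(I δ)` (`χ σ = [σ (Iδ) ≠ Iδ]`, the Kummer character of `-m = N_{F(δ)/F}(δ)`).  **`cor_{S'} [u] = [χ]`** in `H¹(Γ_F, ℤ/2)`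
(`cor_quadraticKummer_eq`): the degree-`1` corestriction is the transfer (tree `cores_eq_cor`), computed on the representatives
`{1, τ}` (`τ δ = -δ`): for `g ∈ S'` it is `[gγ ≠ γ] + [g(τγ) ≠ τγ] = [g I ≠ I]`, for `g ∉ S'` it is
`[gγ ≠ τγ] + [g(τγ) ≠ γ] = [g I = I]`, and both equal `χ g`.  Also: the quadratic characters as `1`-cocycles of the trivial
module `ℤ/2` (`exists_quadraticCocycle`, `exists_quadraticCocycle_subgroup`), and `mem_galFixing_adjoin_simple_iff`.

Use (N4/N5 of the road): with `m = -e`, `e` totally positive, `F(δ)` is totally complex and `χ = χ_{Γ_{F(√e)}}`; by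
`…ShaThreeBaseGysinTwo.mem_range_cor_of_resH_two_eq_zero` every class of `H²(F, T)` dying on `Γ_{F(√e)}` is a corestriction
from `Γ_{F(δ)}`.  HONEST FRAMING: THEOREMS ONLY; closes no item; BSD is not proved by any of this.
References: [NeukirchSchmidtWingberg2008] I §5 (transfer / cor in degree 1); [SerreLocalFields1979] VII §8; [SerreGaloisCohomology1997] I §2.5.
-/

set_option autoImplicit false
-- the Theorems namespace of this sub repeats the summit name by design (D-0017 nested layout)
set_option linter.dupNamespace false

noncomputable section

open CategoryTheory Function Field
open scoped Classical
open _root_.TopRep _root_.ContRepresentation _root_.ContinuousCohomology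
open Literature.NumberTheory.GaloisRepresentations
open Literature.NumberTheory.GaloisRepresentations.LocalWeilDatum

namespace Summit.BirchSwinnertonDyer.BirchSwinnertonDyer.Theorems.SignedEC.ShaThreeBase

section Transfer

variable {F : Type} [Field F] [NumberField F]

/-! ### Elements of `F̄` moved to `±` themselves -/

/-- In `F̄` (characteristic `0`), `-a = a` forces `a = 0`. [folklore] -/
theorem neg_ne_self_of_ne_zero {a : AlgebraicClosure F} (ha : a ≠ 0) : -a ≠ a := fun h => by
  haveI : CharZero (AlgebraicClosure F) := charZero_of_injective_algebraMap (algebraMap F _).injective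
  have h2 : (2 : AlgebraicClosure F) * a = 0 := by rw [two_mul]; nth_rewrite 1 [← h]; rw [neg_add_cancel]
  exact ha ((mul_eq_zero.1 h2).resolve_left two_ne_zero)

omit [NumberField F] in
/-- If `x² = y` and `σ y = y` then `σ x = ± x`. [folklore] -/
theorem smul_eq_or_eq_neg_of_sq (σ : absoluteGaloisGroup F) {x y : AlgebraicClosure F} (hx : x * x = y) (hy : σ • y = y) :
    σ • x = x ∨ σ • x = -x := by
  have h : (σ • x) * (σ • x) = x * x := by rw [← smul_mul', hx, hy]
  exact mul_self_eq_mul_self_iff.1 h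

omit [NumberField F] in
/-- If `x² = y` and `σ y = z` with `y' ² = z`... : if `(σ x)² = y'²` then `σ x = ± y'`. [folklore] -/
theorem smul_eq_or_eq_neg_of_sq_eq (σ : absoluteGaloisGroup F) {x y' : AlgebraicClosure F}
    (h : σ • (x * x) = y' * y') : σ • x = y' ∨ σ • x = -y' := by
  rw [smul_mul'] at h
  exact mul_self_eq_mul_self_iff.1 h

/-- An element of `F̄` fixed by `Γ_F` lies in `F` (`F̄/F` is Galois in characteristic `0`). [cite: SerreGaloisCohomology1997, II §1.1] -/
theorem mem_range_algebraMap_of_forall_smul_eq (x : AlgebraicClosure F) (h : ∀ σ : absoluteGaloisGroup F, σ • x = x) :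
    x ∈ (algebraMap F (AlgebraicClosure F)).range := by
  haveI : IsGalois F (AlgebraicClosure F) := IsGalois.mk
  have hmem : x ∈ (⊥ : IntermediateField F (AlgebraicClosure F)) := by
    rw [← InfiniteGalois.fixedField_fixingSubgroup (⊥ : IntermediateField F (AlgebraicClosure F)),
      IntermediateField.fixingSubgroup_bot, IntermediateField.mem_fixedField_iff]
    intro g _
    exact h g
  obtain ⟨a, ha⟩ := IntermediateField.mem_bot.mp hmem
  exact ⟨a, ha⟩

omit [NumberField F] in
/-- **Membership in `Γ_{F(x)}`**: `σ ∈ galFixing F F(x) ↔ σ x = x`. [folklore] -/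
theorem mem_galFixing_adjoin_simple_iff (x : AlgebraicClosure F) (σ : absoluteGaloisGroup F) :
    σ ∈ galFixing F (IntermediateField.adjoin F {x}) ↔ σ • x = x := by
  rw [mem_galFixing_iff]
  refine ⟨fun h => h x (IntermediateField.mem_adjoin_simple_self F x), fun h y hy => ?_⟩
  -- `F(x)` lies in the fixed field of `σ`
  have hpow : ∀ k : ℤ, (σ ^ k) • x = x := by
    intro k
    induction k using Int.induction_on with
    | zero => rw [zpow_zero, one_smul]
    | succ n ih => rw [zpow_add_one, mul_smul, h, ih]
    | pred n ih =>
      rw [zpow_sub_one, mul_smul]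
      have hinv : σ⁻¹ • x = x := by rw [inv_smul_eq_iff, h]
      rw [hinv, ih]
  have hle : IntermediateField.adjoin F {x} ≤
      IntermediateField.fixedField (Subgroup.zpowers (absoluteGaloisGroup.toAlgEquiv F σ)) := by
    rw [IntermediateField.adjoin_simple_le_iff, IntermediateField.mem_fixedField_iff]
    intro g hg
    obtain ⟨k, rfl⟩ := Subgroup.mem_zpowers_iff.1 hg
    rw [← map_zpow, ← absoluteGaloisGroup.smul_def]
    exact hpow k
  have := hle hy
  rw [IntermediateField.mem_fixedField_iff] at this
  have h1 := this (absoluteGaloisGroup.toAlgEquiv F σ) (Subgroup.mem_zpowers _)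
  rw [absoluteGaloisGroup.smul_def]
  exact h1

/-! ### Quadratic characters as `1`-cocycles of the trivial module `ℤ/2` -/

omit [NumberField F] in
/-- The function `σ ↦ [σ x ≠ x] ∈ ℤ/2` is locally constant on `Γ_F` (constant on the cosets of the open `Γ_{F(x)}`). [folklore] -/
theorem isLocallyConstant_quadraticBit (x : AlgebraicClosure F) :
    IsLocallyConstant fun σ : absoluteGaloisGroup F => (if σ • x = x then (0 : ZMod 2) else 1) := by
  classical
  refine (IsLocallyConstant.iff_exists_open _).2 fun σ => ?_
  refine ⟨(fun σ' => σ⁻¹ * σ') ⁻¹' (galFixing F (IntermediateField.adjoin F {x}) : Set (absoluteGaloisGroup F)),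
    (isOpen_galFixing_adjoin x).preimage (continuous_const_mul σ⁻¹), ?_, fun σ' hσ' => ?_⟩
  · change σ⁻¹ * σ ∈ galFixing F (IntermediateField.adjoin F {x})
    rw [inv_mul_cancel]; exact Subgroup.one_mem _
  · change σ⁻¹ * σ' ∈ galFixing F (IntermediateField.adjoin F {x}) at hσ'
    rw [mem_galFixing_adjoin_simple_iff, mul_smul, inv_smul_eq_iff] at hσ'
    simp only [hσ']

/-- **The quadratic character `σ ↦ [σ x ≠ x]` of `F(x)/F`** (`x² ∈ F`, `x ≠ 0`) as a continuous `1`-cocycle of the trivial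
`Γ_F`-module `ℤ/2`. [cite: NeukirchSchmidtWingberg2008, I §5] -/
theorem exists_quadraticCocycle (x : AlgebraicClosure F) (c : F) (hx : x * x = algebraMap F _ c) (hx0 : x ≠ 0) :
    ∃ χ : contOneCocycles (ContinuousRep.trivial (absoluteGaloisGroup F) ℤ (ZMod 2)).toTopRep,
      ∀ σ, χ.1 σ = if σ • x = x then 0 else 1 := by
  classical
  have hpm : ∀ σ : absoluteGaloisGroup F, σ • x = x ∨ σ • x = -x := fun σ =>
    smul_eq_or_eq_neg_of_sq σ hx (smul_algebraMap σ c)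
  have hne : -x ≠ x := neg_ne_self_of_ne_zero hx0
  refine ⟨⟨⟨fun σ => if σ • x = x then 0 else 1, (isLocallyConstant_quadraticBit x).continuous⟩, fun σ τ => ?_⟩,
    fun σ => rfl⟩
  change (if (σ * τ) • x = x then (0 : ZMod 2) else 1) =
    (if σ • x = x then (0 : ZMod 2) else 1) + (if τ • x = x then (0 : ZMod 2) else 1)
  rw [mul_smul]
  rcases hpm τ with hτ | hτ <;> rcases hpm σ with hσ | hσ <;>
    simp only [hτ, hσ, smul_neg, neg_neg, hne, if_true, if_false] <;> decide

/-- **The Kummer character `h ↦ [h γ ≠ γ]` of `Γ_{F(δ)}`** (`γ² = δ`, `γ ≠ 0`) as a continuous `1`-cocycle of the trivial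
module `ℤ/2` restricted to `Γ_{F(δ)}`. [cite: NeukirchSchmidtWingberg2008, I §5] -/
theorem exists_quadraticCocycle_subgroup (δ γ : AlgebraicClosure F) (hγ : γ * γ = δ) (hγ0 : γ ≠ 0) :
    ∃ u : contOneCocycles (subgroupRep (ContinuousRep.trivial (absoluteGaloisGroup F) ℤ (ZMod 2)).toTopRep
        (galFixing F (IntermediateField.adjoin F {δ}))),
      ∀ h, u.1 h = if (h : absoluteGaloisGroup F) • γ = γ then 0 else 1 := by
  classical
  have hne : -γ ≠ γ := neg_ne_self_of_ne_zero hγ0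
  have hpm : ∀ h : galFixing F (IntermediateField.adjoin F {δ}),
      (h : absoluteGaloisGroup F) • γ = γ ∨ (h : absoluteGaloisGroup F) • γ = -γ := fun h =>
    smul_eq_or_eq_neg_of_sq _ hγ ((mem_galFixing_adjoin_simple_iff δ _).1 h.2)
  refine ⟨⟨⟨fun h => if (h : absoluteGaloisGroup F) • γ = γ then 0 else 1,
    (isLocallyConstant_quadraticBit γ).continuous.comp continuous_subtype_val⟩, fun σ τ => ?_⟩, fun h => rfl⟩
  change (if ((σ * τ : galFixing F (IntermediateField.adjoin F {δ})) : absoluteGaloisGroup F) • γ = γ then (0 : ZMod 2) else 1) =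
    (if (σ : absoluteGaloisGroup F) • γ = γ then (0 : ZMod 2) else 1) +
      (if (τ : absoluteGaloisGroup F) • γ = γ then (0 : ZMod 2) else 1)
  rw [Subgroup.coe_mul, mul_smul]
  rcases hpm τ with hτ | hτ <;> rcases hpm σ with hσ | hσ <;>
    simp only [hτ, hσ, smul_neg, neg_neg, hne, if_true, if_false] <;> decide

/-! ### The transfer identity -/

-- the sixteen sign cases are closed by one `simp only` call each; not every case uses every listed fact
set_option linter.unusedSimpArgs false in
/-- **`cor_{Γ_{F(δ)}} κ(δ) = κ(-δ²)` at level `2`, explicitly**: with `δ² = m ∈ F`, `δ ∉ F`, `γ² = δ`, `I² = -1`, the degree-`1`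
corestriction of the Kummer character `h ↦ [hγ ≠ γ]` of `Γ_{F(δ)}` is the quadratic character `σ ↦ [σ(Iδ) ≠ Iδ]` of
`F(√-m)/F` (the transfer on the representatives `{1, τ}`, `τδ = -δ`). [cite: NeukirchSchmidtWingberg2008, I §5]
[cite: SerreGaloisCohomology1997, I §2.5] -/
theorem cor_quadraticKummer_eq (I δ γ : AlgebraicClosure F) (m : F) (hI : I * I = -1)
    (hδ : δ * δ = algebraMap F (AlgebraicClosure F) m) (hδF : δ ∉ (algebraMap F (AlgebraicClosure F)).range)
    (hγ : γ * γ = δ)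
    [Fintype (absoluteGaloisGroup F ⧸ galFixing F (IntermediateField.adjoin F {δ}))]
    [IsClosed (galFixing F (IntermediateField.adjoin F {δ}) : Set (absoluteGaloisGroup F))]
    (χ : contOneCocycles (ContinuousRep.trivial (absoluteGaloisGroup F) ℤ (ZMod 2)).toTopRep)
    (hχ : ∀ σ, χ.1 σ = if σ • (I * δ) = I * δ then 0 else 1)
    (u : contOneCocycles (subgroupRep (ContinuousRep.trivial (absoluteGaloisGroup F) ℤ (ZMod 2)).toTopRep
        (galFixing F (IntermediateField.adjoin F {δ}))))
    (hu : ∀ h, u.1 h = if (h : absoluteGaloisGroup F) • γ = γ then 0 else 1) :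
    cores (ContinuousRep.trivial (absoluteGaloisGroup F) ℤ (ZMod 2)).toTopRep (galFixing F (IntermediateField.adjoin F {δ}))
        (isOpen_galFixing_adjoin δ) (oneCocycleClass _ u) = oneCocycleClass _ χ := by
  classical
  have hS'o : IsOpen (galFixing F (IntermediateField.adjoin F {δ}) : Set (absoluteGaloisGroup F)) := isOpen_galFixing_adjoin δ
  have hidx : (galFixing F (IntermediateField.adjoin F {δ})).index = 2 := index_galFixing_adjoin_eq_two m δ hδ hδF
  have hmem : ∀ σ : absoluteGaloisGroup F, σ ∈ galFixing F (IntermediateField.adjoin F {δ}) ↔ σ • δ = δ := fun σ => mem_galFixing_adjoin_simple_iff δ σ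
  -- non-vanishing
  have hδ0 : δ ≠ 0 := fun h => hδF ⟨0, by rw [map_zero, h]⟩
  have hγ0 : γ ≠ 0 := fun h => hδ0 (by rw [← hγ, h, mul_zero])
  have hI0 : I ≠ 0 := fun h => by rw [h, mul_zero] at hI; exact one_ne_zero (neg_eq_zero.1 hI.symm)
  have hIγ0 : I * γ ≠ 0 := mul_ne_zero hI0 hγ0
  have hIδ0 : I * δ ≠ 0 := mul_ne_zero hI0 hδ0
  -- `τ` with `τ δ = -δ`
  obtain ⟨τ, hτ⟩ : ∃ τ : absoluteGaloisGroup F, τ • δ = -δ := by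
    by_contra hall
    refine hδF (mem_range_algebraMap_of_forall_smul_eq δ fun σ => ?_)
    rcases smul_eq_or_eq_neg_of_sq σ hδ (smul_algebraMap σ m) with h | h
    · exact h
    · exact absurd ⟨σ, h⟩ hall
  have hτS : τ ∉ galFixing F (IntermediateField.adjoin F {δ}) := fun h => neg_ne_self_of_ne_zero hδ0 (hτ.symm.trans ((hmem τ).1 h))
  -- signs
  have hI' : ∀ σ : absoluteGaloisGroup F, σ • I = I ∨ σ • I = -I := fun σ =>
    smul_eq_or_eq_neg_of_sq σ hI (by rw [smul_neg, smul_one])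
  set γ' := τ • γ with hγ'def
  have hγ'sq : γ' * γ' = (I * γ) * (I * γ) := by
    rw [hγ'def, ← smul_mul', hγ, hτ, mul_mul_mul_comm, hI, hγ, neg_one_mul]
  have hγ'pm : γ' = I * γ ∨ γ' = -(I * γ) := mul_self_eq_mul_self_iff.1 hγ'sq
  -- the section `{1, τ}` and the transfer
  let s : absoluteGaloisGroup F ⧸ galFixing F (IntermediateField.adjoin F {δ}) → absoluteGaloisGroup F := fun q =>
    if q = ((1 : absoluteGaloisGroup F) : absoluteGaloisGroup F ⧸ galFixing F (IntermediateField.adjoin F {δ})) then 1 else τ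
  have hq1 : ∀ a : absoluteGaloisGroup F,
      ((a : absoluteGaloisGroup F ⧸ galFixing F (IntermediateField.adjoin F {δ})) = ((1 : absoluteGaloisGroup F) : absoluteGaloisGroup F ⧸ galFixing F (IntermediateField.adjoin F {δ}))) ↔ a ∈ galFixing F (IntermediateField.adjoin F {δ}) := by
    intro a
    rw [QuotientGroup.eq, mul_one, inv_mem_iff]
  have hs : ∀ q : absoluteGaloisGroup F ⧸ galFixing F (IntermediateField.adjoin F {δ}), (s q : absoluteGaloisGroup F ⧸ galFixing F (IntermediateField.adjoin F {δ})) = q := by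
    intro q
    by_cases h : q = ((1 : absoluteGaloisGroup F) : absoluteGaloisGroup F ⧸ galFixing F (IntermediateField.adjoin F {δ}))
    · rw [show s q = 1 from if_pos h, h]
    · rw [show s q = τ from if_neg h]
      have hq : q ∈ ({((1 : absoluteGaloisGroup F) : absoluteGaloisGroup F ⧸ galFixing F (IntermediateField.adjoin F {δ})), (τ : absoluteGaloisGroup F ⧸ galFixing F (IntermediateField.adjoin F {δ}))} :
          Finset _) := by
        rw [← univ_quotient_eq_pair_of_index_two hidx hτS]; exact Finset.mem_univ q
      rw [Finset.mem_insert, Finset.mem_singleton] at hq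
      exact (hq.resolve_left h).symm
  rw [cores_oneCocycleClass _ (galFixing F (IntermediateField.adjoin F {δ})) (isOpen_galFixing_adjoin δ) hs u]
  refine congrArg _ (Subtype.ext (ContinuousMap.ext fun g => ?_))
  rw [transferCocycle_apply, transferFun_apply, hχ,
    show (Finset.univ : Finset (absoluteGaloisGroup F ⧸ galFixing F (IntermediateField.adjoin F {δ}))) = _ from univ_quotient_eq_pair_of_index_two hidx hτS,
    Finset.sum_pair (one_ne_coe_of_not_mem hτS)]
  change u.1 _ + u.1 _ = _
  rw [hu, hu, Literature.NumberTheory.EllipticCurves.schreierElt_coe, Literature.NumberTheory.EllipticCurves.schreierElt_coe]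
  have hs1 : s ((1 : absoluteGaloisGroup F) : absoluteGaloisGroup F ⧸ galFixing F (IntermediateField.adjoin F {δ})) = 1 :=
    if_pos rfl
  have hsτ : s (τ : absoluteGaloisGroup F ⧸ galFixing F (IntermediateField.adjoin F {δ})) = τ :=
    if_neg (fun h => hτS ((hq1 τ).1 h))
  have hg1 : g • ((1 : absoluteGaloisGroup F) : absoluteGaloisGroup F ⧸ galFixing F (IntermediateField.adjoin F {δ})) =
      (g : absoluteGaloisGroup F ⧸ galFixing F (IntermediateField.adjoin F {δ})) := by
    rw [MulAction.Quotient.smul_coe, smul_eq_mul, mul_one]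
  have hgτq : g • (τ : absoluteGaloisGroup F ⧸ galFixing F (IntermediateField.adjoin F {δ})) =
      ((g * τ : absoluteGaloisGroup F) : absoluteGaloisGroup F ⧸ galFixing F (IntermediateField.adjoin F {δ})) := by
    rw [MulAction.Quotient.smul_coe, smul_eq_mul]
  have hneγ := neg_ne_self_of_ne_zero hγ0
  have hneIγ := neg_ne_self_of_ne_zero hIγ0
  have hneIδ := neg_ne_self_of_ne_zero hIδ0
  have hII : ∀ y : AlgebraicClosure F, I * (I * y) = -y := fun y => by rw [← mul_assoc, hI, neg_one_mul]
  have h11 : (1 : ZMod 2) + 1 = 0 := by decide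
  by_cases hg : g ∈ galFixing F (IntermediateField.adjoin F {δ})
  · -- `g ∈ S'`: the terms are `[gγ ≠ γ]` and `[g γ' ≠ γ']`, `γ' = τ γ`
    have hgδ : g • δ = δ := (hmem g).1 hg
    have hgτ : g * τ ∉ galFixing F (IntermediateField.adjoin F {δ}) := fun h =>
      hτS ((Subgroup.mul_mem_cancel_left (galFixing F (IntermediateField.adjoin F {δ})) hg).1 h)
    have hsg : s (g : absoluteGaloisGroup F ⧸ galFixing F (IntermediateField.adjoin F {δ})) = 1 := by
      rw [(hq1 g).2 hg, hs1]
    have hsgτ : s ((g * τ : absoluteGaloisGroup F) : absoluteGaloisGroup F ⧸ galFixing F (IntermediateField.adjoin F {δ})) = τ :=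
      if_neg (fun h => hgτ ((hq1 _).1 h))
    have hgγ : g • γ = γ ∨ g • γ = -γ := smul_eq_or_eq_neg_of_sq g hγ hgδ
    simp only [hg1, hgτq, hsg, hsgτ, hs1, hsτ, inv_one, one_mul, mul_smul, one_smul, inv_smul_eq_iff, smul_mul', hgδ]
    rw [← hγ'def]
    rcases hI' g with ha | ha <;> rcases hgγ with hb | hb <;> rcases hγ'pm with hw | hw <;>
      simp only [ha, hb, hw, smul_mul', smul_neg, hII, neg_mul, mul_neg, neg_neg, if_true, hneγ, hneIγ, hneIδ, hneγ.symm,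
        hneIγ.symm, hneIδ.symm, if_false, add_zero, zero_add] <;> exact h11
  · -- `g ∉ S'`: the terms are `[gγ ≠ τγ]` and `[g(τγ) ≠ γ]`
    have hgδ : g • δ = -δ := by
      rcases smul_eq_or_eq_neg_of_sq g hδ (smul_algebraMap g m) with h | h
      · exact absurd ((hmem g).2 h) hg
      · exact h
    have hgτ : g * τ ∈ galFixing F (IntermediateField.adjoin F {δ}) := mul_mem_of_not_mem_of_index_two hidx hg hτS
    have hsg : s (g : absoluteGaloisGroup F ⧸ galFixing F (IntermediateField.adjoin F {δ})) = τ :=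
      if_neg (fun h => hg ((hq1 g).1 h))
    have hsgτ : s ((g * τ : absoluteGaloisGroup F) : absoluteGaloisGroup F ⧸ galFixing F (IntermediateField.adjoin F {δ})) = 1 := by
      rw [(hq1 _).2 hgτ, hs1]
    have hgγ : g • γ = γ' ∨ g • γ = -γ' := by
      refine smul_eq_or_eq_neg_of_sq_eq g ?_
      rw [hγ, hgδ, hγ'def, ← smul_mul', hγ, hτ]
    simp only [hg1, hgτq, hsg, hsgτ, hs1, hsτ, inv_one, one_mul, mul_one, mul_smul, one_smul, inv_smul_eq_iff, smul_mul', hgδ]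
    rw [← hγ'def]
    rcases hI' g with ha | ha <;> rcases hγ'pm with hw | hw <;> rcases hgγ with hb | hb <;>
      simp only [ha, hb, hw, smul_mul', smul_neg, hII, neg_mul, mul_neg, neg_neg, if_true, hneγ, hneIγ, hneIδ, hneγ.symm,
        hneIγ.symm, hneIδ.symm, if_false, add_zero, zero_add] <;> exact h11

end Transfer

end Summit.BirchSwinnertonDyer.BirchSwinnertonDyer.Theorems.SignedEC.ShaThreeBase

end
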